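import Mathlib
import HarnessLib

/-!
# Integration of continuous functions against a bounded non-archimedean distribution

A *distribution* on a profinite space `X = lim X_n` with values in a non-archimedean field `𝕜` is
a compatible system of finitely additive set functions `μ_n` on the level-`n` cells; it is a
*measure* when it is bounded, `‖μ_n(a)‖ ≤ C`, and a measure integrates every continuous function:
`∫ f dμ = lim_n ∑_{a ∈ X_n} μ_n(a) f(x_a)` for any choice of points `x_a` in the cells
(Mazur–Tate–Teitelbaum 1986, §I.11, "measures and integrals"; Mazur–Swinnerton-Dyer 1974, §7;
Washington, *Cyclotomic fields*, §12.2; Lang, *Cyclotomic fields*, Ch. 4 §1).  The tree's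
one-variable `p`-adic `L`-function files (`PAdicMeasureTransform`, `PAdicMeasureMoments`,
`PAdicLFunctionInterpolationProofs`) carry out this limit by hand for each integrand
(`(ℓ(x) choose k)`, `χ(x)`, `x^j`); this file proves it ONCE, abstractly, so that the two-variable
`p`-adic `L`-functions of Hida families (Greenberg–Stevens 1993, Kitagawa 1994; named fact
`greenbergStevens_kitagawa_twoVariable_interpolation_allBranches`) can be set up on `ℤ_p × ℤ_p`
(and on `ℤ_p^× × ℤ_p^×` in Teichmüller–`γ` class coordinates) without redoing the analysis.

Everything here is a definition with a body or a theorem; there are no named facts.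

## Main definitions

* `ProfiniteTower X` — a presentation of a (pseudo)metric space `X` as a tower of finite levels:
  finite types of cells `Cell n`, locally constant projections `proj n : X → Cell n` compatible with
  transition maps `trans n : Cell (n+1) → Cell n`, a chosen point `repr n a` in each cell, and the
  shrinking condition: points in the same level-`n` cell are uniformly close as `n → ∞`.
  Instances: `ProfiniteTower.padicInt p` (`ℤ_p`, cells `ℤ/p^n`, `proj = toZModPow`, representatives
  `a ↦ a.val`) and `ProfiniteTower.prod` (products, e.g. `ℤ_p × ℤ_p`).
* `BoundedDistribution T 𝕜` — a bounded distribution on the tower: `μ n : Cell n → 𝕜` with the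
  distribution relation `∑_{trans b = a} μ (n+1) b = μ n a` and a bound `‖μ n a‖ ≤ bound`.
* `BoundedDistribution.riemannSum D f n = ∑_a μ n a · f (repr n a)` and
  `BoundedDistribution.integral D f = lim_n riemannSum D f n` (`∫ f dμ`).

## Main results (for `f` uniformly continuous — automatic on compact `X` — and `𝕜` complete)

* `tendsto_riemannSum_integral` — the Riemann sums converge to `∫ f dμ`;
  `tendsto_sum_mul_apply_integral` — so do the Riemann sums formed with ANY points of the cells;
* `norm_integral_le` — `‖∫ f dμ‖ ≤ bound · sup ‖f‖`;
* `integral_add`, `integral_sub`, `integral_const_mul`, `integral_zero_fun` — linearity;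
* `integral_eq_sum_of_factorsThrough` — for `f = g ∘ proj m` locally constant,
  `∫ f dμ = ∑_a μ m a · g a` (no continuity hypothesis);
* `tendsto_integral_of_forall_norm_sub_le` — uniform limits pass under the integral.

## References

* B. Mazur, J. Tate, J. Teitelbaum, *On `p`-adic analogues of the conjectures of Birch and
  Swinnerton-Dyer*, Invent. Math. 84 (1986), 1–48, §I.11. [MazurTateTeitelbaum1986Invent]
* B. Mazur, P. Swinnerton-Dyer, *Arithmetic of Weil curves*, Invent. Math. 25 (1974), 1–61, §7.
  [MazurSwinnertonDyer1974Invent]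
* L. C. Washington, *Introduction to cyclotomic fields*, GTM 83, 2nd ed., Springer 1997, §12.2.
-/

noncomputable section

open Filter Topology

namespace Literature.NumberTheory.EllipticCurves

/-! ### Profinite tower presentations -/

/-- A **profinite tower presentation** of a pseudometric space `X`: finite levels `Cell n`, locally
constant projections `proj n : X → Cell n` compatible with the transition maps
`trans n : Cell (n + 1) → Cell n`, a chosen point `repr n a ∈ X` of each cell, and the shrinking
condition that two points with the same level-`n` cell are uniformly close for `n` large.  The
model is `X = ℤ_p`, `Cell n = ℤ/p^nℤ`, `proj n = (· mod p^n)`, `repr n a = a.val`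
(`ProfiniteTower.padicInt`); products are `ProfiniteTower.prod`. [folklore] -/
structure ProfiniteTower (X : Type*) [PseudoMetricSpace X] where
  /-- the finite set of cells of level `n` -/
  Cell : ℕ → Type
  /-- each level is finite -/
  [instFintype : ∀ n, Fintype (Cell n)]
  /-- each level has decidable equality -/
  [instDecidableEq : ∀ n, DecidableEq (Cell n)]
  /-- the level-`n` cell of a point -/
  proj : (n : ℕ) → X → Cell n
  /-- the level-`n` cell containing a given level-`(n + 1)` cell -/
  trans : (n : ℕ) → Cell (n + 1) → Cell n
  /-- a chosen point of each cell -/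
  repr : (n : ℕ) → Cell n → X
  /-- the chosen point lies in its cell -/
  proj_repr : ∀ (n : ℕ) (a : Cell n), proj n (repr n a) = a
  /-- compatibility of the projections with the transition maps -/
  trans_proj : ∀ (n : ℕ) (x : X), trans n (proj (n + 1) x) = proj n x
  /-- cells shrink uniformly: points of a common level-`n` cell are `ε`-close for `n ≥ N(ε)` -/
  exists_forall_dist_lt : ∀ ε : ℝ, 0 < ε → ∃ N : ℕ, ∀ n, N ≤ n → ∀ x y : X,
    proj n x = proj n y → dist x y < ε

attribute [instance] ProfiniteTower.instFintype ProfiniteTower.instDecidableEq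

namespace ProfiniteTower

variable {X : Type*} [PseudoMetricSpace X] (T : ProfiniteTower X)

/-- The iterated transition map `Cell (n + k) → Cell n`. [folklore] -/
def transAdd (n : ℕ) : (k : ℕ) → T.Cell (n + k) → T.Cell n
  | 0 => id
  | k + 1 => fun b => transAdd n k (T.trans (n + k) b)

/-- `transAdd n 0` is the identity. [folklore] -/
@[simp] theorem transAdd_zero (n : ℕ) (a : T.Cell n) : T.transAdd n 0 a = a := rfl

/-- `transAdd n (k + 1) = transAdd n k ∘ trans (n + k)`. [folklore] -/
theorem transAdd_succ (n k : ℕ) (b : T.Cell (n + k + 1)) :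
    T.transAdd n (k + 1) b = T.transAdd n k (T.trans (n + k) b) := rfl

/-- The iterated transition map is compatible with the projections:
`transAdd n k (proj (n + k) x) = proj n x`. [folklore] -/
theorem transAdd_proj (n : ℕ) : ∀ (k : ℕ) (x : X), T.transAdd n k (T.proj (n + k) x) = T.proj n x
  | 0, _ => rfl
  | k + 1, x => by
    show T.transAdd n k (T.trans (n + k) (T.proj (n + k + 1) x)) = T.proj n x
    rw [T.trans_proj (n + k) x, transAdd_proj n k x]

/-- Two levels down: the level-`n` cell of the representative of a level-`(n+1)` cell `b` is
`trans n b`. [folklore] -/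
theorem proj_repr_succ (n : ℕ) (b : T.Cell (n + 1)) : T.proj n (T.repr (n + 1) b) = T.trans n b := by
  rw [← T.trans_proj n, T.proj_repr]

/-- `proj n (repr (n + k) b) = transAdd n k b`. [folklore] -/
theorem proj_repr_add (n k : ℕ) (b : T.Cell (n + k)) :
    T.proj n (T.repr (n + k) b) = T.transAdd n k b := by
  rw [← T.transAdd_proj n k, T.proj_repr]

/-- A finer cell determines the coarser one: `proj (n + k) x = proj (n + k) y → proj n x = proj n y`.
[folklore] -/
theorem proj_eq_of_proj_add_eq {n k : ℕ} {x y : X} (h : T.proj (n + k) x = T.proj (n + k) y) :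
    T.proj n x = T.proj n y := by
  rw [← T.transAdd_proj n k x, ← T.transAdd_proj n k y, h]

/-- **Uniform continuity in tower form**: a uniformly continuous `f` varies by at most `ε` on the
level-`n` cells for all `n ≥ N(ε)`. [folklore] -/
theorem exists_forall_norm_sub_le {E : Type*} [SeminormedAddCommGroup E] {f : X → E}
    (hf : UniformContinuous f) {ε : ℝ} (hε : 0 < ε) :
    ∃ N : ℕ, ∀ n, N ≤ n → ∀ x y : X, T.proj n x = T.proj n y → ‖f x - f y‖ ≤ ε := by
  obtain ⟨η, hη, h⟩ := Metric.uniformContinuous_iff.mp hf ε hε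
  obtain ⟨N, hN⟩ := T.exists_forall_dist_lt η hη
  refine ⟨N, fun n hn x y hxy => ?_⟩
  rw [← dist_eq_norm]
  exact (h (hN n hn x y hxy)).le

end ProfiniteTower

/-! ### Bounded distributions and their Riemann sums -/

/-- A **bounded distribution** (a *measure* in the terminology of Mazur–Tate–Teitelbaum 1986, §I.11)
on a profinite tower with values in a normed field `𝕜`: finitely additive level functions
`μ n : Cell n → 𝕜` satisfying the distribution relation `∑_{trans n b = a} μ (n + 1) b = μ n a` and
uniformly bounded by `bound`. [cite: MazurTateTeitelbaum1986Invent, §I.11] -/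
structure BoundedDistribution {X : Type*} [PseudoMetricSpace X] (T : ProfiniteTower X)
    (𝕜 : Type*) [NormedField 𝕜] where
  /-- the value on a level-`n` cell -/
  μ : (n : ℕ) → T.Cell n → 𝕜
  /-- the distribution (additivity) relation -/
  sum_fiber : ∀ (n : ℕ) (a : T.Cell n),
    ∑ b ∈ Finset.univ.filter (fun b : T.Cell (n + 1) => T.trans n b = a), μ (n + 1) b = μ n a
  /-- a uniform bound for the values -/
  bound : ℝ
  /-- the bound is non-negative -/
  bound_nonneg : 0 ≤ bound
  /-- boundedness -/
  norm_le : ∀ (n : ℕ) (a : T.Cell n), ‖μ n a‖ ≤ bound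

namespace BoundedDistribution

variable {X : Type*} [PseudoMetricSpace X] {T : ProfiniteTower X}
variable {𝕜 : Type*} [NormedField 𝕜]
variable (D : BoundedDistribution T 𝕜)

/-- The level-`n` **Riemann sum** `∑_a μ n a · f (repr n a)` of `f` against `D`. [folklore] -/
def riemannSum (f : X → 𝕜) (n : ℕ) : 𝕜 := ∑ a : T.Cell n, D.μ n a * f (T.repr n a)

/-- Unfolding lemma for `riemannSum`. [folklore] -/
theorem riemannSum_def (f : X → 𝕜) (n : ℕ) :
    D.riemannSum f n = ∑ a : T.Cell n, D.μ n a * f (T.repr n a) := rfl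

/-- **Refining a level-`n` sum along the distribution relation**:
`∑_a μ n a · g a = ∑_b μ (n + 1) b · g (trans n b)`. [folklore] -/
theorem sum_mul_eq_sum_succ (n : ℕ) (g : T.Cell n → 𝕜) :
    ∑ a : T.Cell n, D.μ n a * g a = ∑ b : T.Cell (n + 1), D.μ (n + 1) b * g (T.trans n b) := by
  classical
  rw [← Finset.sum_fiberwise_of_maps_to (s := (Finset.univ : Finset (T.Cell (n + 1))))
    (t := (Finset.univ : Finset (T.Cell n))) (g := T.trans n) (fun _ _ => Finset.mem_univ _)]
  refine Finset.sum_congr rfl fun a _ => ?_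
  rw [← D.sum_fiber n a, Finset.sum_mul]
  refine Finset.sum_congr rfl fun b hb => ?_
  rw [(Finset.mem_filter.mp hb).2]

/-- Iterated refinement: `∑_a μ n a · g a = ∑_b μ (n + k) b · g (transAdd n k b)`. [folklore] -/
theorem sum_mul_eq_sum_add (n : ℕ) (g : T.Cell n → 𝕜) :
    ∀ k : ℕ, ∑ a : T.Cell n, D.μ n a * g a =
      ∑ b : T.Cell (n + k), D.μ (n + k) b * g (T.transAdd n k b)
  | 0 => by simp
  | k + 1 => by
    rw [sum_mul_eq_sum_add n g k, D.sum_mul_eq_sum_succ (n + k)]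
    rfl

/-- The Riemann sums of the zero function vanish. [folklore] -/
@[simp] theorem riemannSum_zero (n : ℕ) : D.riemannSum (fun _ => (0 : 𝕜)) n = 0 := by
  simp [riemannSum]

/-- The Riemann sums are additive in the integrand. [folklore] -/
theorem riemannSum_add (f g : X → 𝕜) (n : ℕ) :
    D.riemannSum (fun x => f x + g x) n = D.riemannSum f n + D.riemannSum g n := by
  simp only [riemannSum, mul_add, Finset.sum_add_distrib]

/-- The Riemann sums are homogeneous in the integrand. [folklore] -/
theorem riemannSum_const_mul (c : 𝕜) (f : X → 𝕜) (n : ℕ) :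
    D.riemannSum (fun x => c * f x) n = c * D.riemannSum f n := by
  simp only [riemannSum, Finset.mul_sum]
  exact Finset.sum_congr rfl fun _ _ => by ring

/-- The Riemann sums are subtractive in the integrand. [folklore] -/
theorem riemannSum_sub (f g : X → 𝕜) (n : ℕ) :
    D.riemannSum (fun x => f x - g x) n = D.riemannSum f n - D.riemannSum g n := by
  simp only [riemannSum, mul_sub, Finset.sum_sub_distrib]

variable [IsUltrametricDist 𝕜]

/-- **A bounded integrand has bounded Riemann sums**: `‖f‖ ≤ M` gives `‖RS f n‖ ≤ bound · M`
(`𝕜` non-archimedean). [folklore] -/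
theorem norm_riemannSum_le {f : X → 𝕜} {M : ℝ} (hM0 : 0 ≤ M) (hM : ∀ x, ‖f x‖ ≤ M) (n : ℕ) :
    ‖D.riemannSum f n‖ ≤ D.bound * M := by
  refine IsUltrametricDist.norm_sum_le_of_forall_le_of_nonneg (mul_nonneg D.bound_nonneg hM0)
    fun a _ => ?_
  rw [norm_mul]
  exact mul_le_mul (D.norm_le n a) (hM _) (norm_nonneg _) D.bound_nonneg

/-- **Riemann sums with other sample points**: if `x a` is any point of the cell `a` at level `n`
and `f` varies by at most `δ` on level-`n` cells, then
`‖∑_a μ n a · f (x a) − RS f n‖ ≤ bound · δ`. [folklore] -/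
theorem norm_sum_mul_apply_sub_riemannSum_le {f : X → 𝕜} {δ : ℝ} (hδ : 0 ≤ δ) {n : ℕ}
    (hf : ∀ x y : X, T.proj n x = T.proj n y → ‖f x - f y‖ ≤ δ)
    {x : T.Cell n → X} (hx : ∀ a, T.proj n (x a) = a) :
    ‖∑ a : T.Cell n, D.μ n a * f (x a) - D.riemannSum f n‖ ≤ D.bound * δ := by
  rw [riemannSum, ← Finset.sum_sub_distrib]
  refine IsUltrametricDist.norm_sum_le_of_forall_le_of_nonneg (mul_nonneg D.bound_nonneg hδ)
    fun a _ => ?_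
  rw [← mul_sub, norm_mul]
  refine mul_le_mul (D.norm_le n a) (hf _ _ ?_) (norm_nonneg _) D.bound_nonneg
  rw [hx, T.proj_repr]

/-- **One refinement step moves the Riemann sum by at most `bound · δ`** when `f` varies by at
most `δ` on level-`n` cells: both sums live on level `n + 1` after refining `RS f n` along the
distribution relation, and the two sample points of a level-`(n+1)` cell lie in one level-`n` cell
(Mazur–Tate–Teitelbaum 1986, §I.11). [cite: MazurTateTeitelbaum1986Invent, §I.11] -/
theorem norm_riemannSum_succ_sub_le {f : X → 𝕜} {δ : ℝ} (hδ : 0 ≤ δ) (n : ℕ)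
    (hf : ∀ x y : X, T.proj n x = T.proj n y → ‖f x - f y‖ ≤ δ) :
    ‖D.riemannSum f (n + 1) - D.riemannSum f n‖ ≤ D.bound * δ := by
  rw [riemannSum, riemannSum, D.sum_mul_eq_sum_succ n (fun a => f (T.repr n a)),
    ← Finset.sum_sub_distrib]
  refine IsUltrametricDist.norm_sum_le_of_forall_le_of_nonneg (mul_nonneg D.bound_nonneg hδ)
    fun b _ => ?_
  rw [← mul_sub, norm_mul]
  refine mul_le_mul (D.norm_le _ _) (hf _ _ ?_) (norm_nonneg _) D.bound_nonneg
  rw [T.proj_repr_succ, T.proj_repr]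

/-- **The Riemann sums are uniformly Cauchy beyond level `N`**: if `f` varies by at most `ε` on
the level-`n` cells for every `n ≥ N`, then `‖RS f m − RS f n‖ ≤ bound · ε` for `N ≤ n ≤ m`
(telescoping and the ultrametric inequality). [folklore] -/
theorem norm_riemannSum_sub_riemannSum_le {f : X → 𝕜} {ε : ℝ} (hε : 0 ≤ ε) {N : ℕ}
    (hf : ∀ n, N ≤ n → ∀ x y : X, T.proj n x = T.proj n y → ‖f x - f y‖ ≤ ε) {n m : ℕ}
    (hn : N ≤ n) (hm : n ≤ m) :
    ‖D.riemannSum f m - D.riemannSum f n‖ ≤ D.bound * ε := by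
  induction m, hm using Nat.le_induction with
  | base => simpa using mul_nonneg D.bound_nonneg hε
  | succ m hm ih =>
    calc ‖D.riemannSum f (m + 1) - D.riemannSum f n‖
        = ‖(D.riemannSum f (m + 1) - D.riemannSum f m) + (D.riemannSum f m - D.riemannSum f n)‖ := by
          rw [sub_add_sub_cancel]
      _ ≤ max ‖D.riemannSum f (m + 1) - D.riemannSum f m‖ ‖D.riemannSum f m - D.riemannSum f n‖ :=
          IsUltrametricDist.norm_add_le_max _ _
      _ ≤ D.bound * ε :=
          max_le (D.norm_riemannSum_succ_sub_le hε m (hf m (hn.trans hm))) ih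

/-- **The Riemann sums of a uniformly continuous function form a Cauchy sequence.** [folklore] -/
theorem cauchySeq_riemannSum {f : X → 𝕜} (hf : UniformContinuous f) :
    CauchySeq (D.riemannSum f) := by
  refine Metric.cauchySeq_iff'.mpr fun ε hε => ?_
  -- make the cell-oscillation of `f` at most `ε / (2 (bound + 1))`
  have hb : 0 < D.bound + 1 := by linarith [D.bound_nonneg]
  obtain ⟨N, hN⟩ := T.exists_forall_norm_sub_le hf (div_pos hε (mul_pos two_pos hb))
  refine ⟨N, fun n hn => ?_⟩
  rw [dist_eq_norm]
  calc ‖D.riemannSum f n - D.riemannSum f N‖ ≤ D.bound * (ε / (2 * (D.bound + 1))) :=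
        D.norm_riemannSum_sub_riemannSum_le (div_pos hε (mul_pos two_pos hb)).le hN le_rfl hn
    _ < ε := by
        rw [mul_div_assoc', div_lt_iff₀ (mul_pos two_pos hb)]
        nlinarith [D.bound_nonneg]

/-! ### The integral -/

/-- The **integral** `∫ f dμ = lim_n ∑_a μ n a · f (repr n a)` of `f` against the bounded
distribution `D` (the junk value of `limUnder` if the Riemann sums diverge; they converge for every
uniformly continuous `f` when `𝕜` is complete, `tendsto_riemannSum_integral`)
(Mazur–Tate–Teitelbaum 1986, §I.11). [cite: MazurTateTeitelbaum1986Invent, §I.11] -/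
def integral (f : X → 𝕜) : 𝕜 := limUnder atTop (D.riemannSum f)

variable [CompleteSpace 𝕜]

/-- **Convergence of the Riemann sums** to the integral, for `f` uniformly continuous and `𝕜`
complete (Mazur–Tate–Teitelbaum 1986, §I.11). [cite: MazurTateTeitelbaum1986Invent, §I.11] -/
theorem tendsto_riemannSum_integral {f : X → 𝕜} (hf : UniformContinuous f) :
    Tendsto (D.riemannSum f) atTop (𝓝 (D.integral f)) :=
  (D.cauchySeq_riemannSum hf).tendsto_limUnder

/-- **Rate of convergence**: if `f` varies by at most `ε` on the level-`n` cells for all `n ≥ N`,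
then `‖∫ f dμ − RS f n‖ ≤ bound · ε` for every `n ≥ N`. [folklore] -/
theorem norm_integral_sub_riemannSum_le {f : X → 𝕜} (hf : UniformContinuous f) {ε : ℝ} (hε : 0 ≤ ε)
    {N : ℕ} (hN : ∀ n, N ≤ n → ∀ x y : X, T.proj n x = T.proj n y → ‖f x - f y‖ ≤ ε) {n : ℕ}
    (hn : N ≤ n) : ‖D.integral f - D.riemannSum f n‖ ≤ D.bound * ε := by
  have hlim : Tendsto (fun m => ‖D.riemannSum f m - D.riemannSum f n‖) atTop
      (𝓝 ‖D.integral f - D.riemannSum f n‖) :=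
    ((D.tendsto_riemannSum_integral hf).sub tendsto_const_nhds).norm
  exact le_of_tendsto hlim (Filter.eventually_atTop.mpr
    ⟨n, fun m hm => D.norm_riemannSum_sub_riemannSum_le hε hN hn hm⟩)

/-- **Riemann sums with arbitrary sample points converge to the integral**: if `x n a` is any point
of the level-`n` cell `a`, then `∑_a μ n a · f (x n a) → ∫ f dμ`
(Mazur–Tate–Teitelbaum 1986, §I.11: the integral does not depend on the choice of points).
[cite: MazurTateTeitelbaum1986Invent, §I.11] -/
theorem tendsto_sum_mul_apply_integral {f : X → 𝕜} (hf : UniformContinuous f)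
    {x : (n : ℕ) → T.Cell n → X} (hx : ∀ n a, T.proj n (x n a) = a) :
    Tendsto (fun n => ∑ a : T.Cell n, D.μ n a * f (x n a)) atTop (𝓝 (D.integral f)) := by
  have h0 : Tendsto (fun n => ∑ a : T.Cell n, D.μ n a * f (x n a) - D.riemannSum f n) atTop (𝓝 0) := by
    refine Metric.tendsto_atTop.mpr fun ε hε => ?_
    have hb : 0 < D.bound + 1 := by linarith [D.bound_nonneg]
    obtain ⟨N, hN⟩ := T.exists_forall_norm_sub_le hf (div_pos hε hb)
    refine ⟨N, fun n hn => ?_⟩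
    rw [dist_zero_right]
    calc ‖∑ a : T.Cell n, D.μ n a * f (x n a) - D.riemannSum f n‖ ≤ D.bound * (ε / (D.bound + 1)) :=
          D.norm_sum_mul_apply_sub_riemannSum_le (div_pos hε hb).le (hN n hn) (hx n)
      _ < ε := by
          rw [mul_div_assoc', div_lt_iff₀ hb]
          nlinarith [D.bound_nonneg]
  have h := h0.add (D.tendsto_riemannSum_integral hf)
  simpa using h

/-- **Boundedness of the integral**: `‖∫ f dμ‖ ≤ bound · M` whenever `‖f‖ ≤ M`
(Mazur–Tate–Teitelbaum 1986, §I.11). [cite: MazurTateTeitelbaum1986Invent, §I.11] -/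
theorem norm_integral_le {f : X → 𝕜} (hf : UniformContinuous f) {M : ℝ} (hM0 : 0 ≤ M)
    (hM : ∀ x, ‖f x‖ ≤ M) : ‖D.integral f‖ ≤ D.bound * M :=
  le_of_tendsto' (D.tendsto_riemannSum_integral hf).norm fun n => D.norm_riemannSum_le hM0 hM n

/-- **Additivity of the integral.** [folklore] -/
theorem integral_add {f g : X → 𝕜} (hf : UniformContinuous f) (hg : UniformContinuous g) :
    D.integral (fun x => f x + g x) = D.integral f + D.integral g := by
  have h := (D.tendsto_riemannSum_integral hf).add (D.tendsto_riemannSum_integral hg)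
  have h' : Tendsto (D.riemannSum (fun x => f x + g x)) atTop (𝓝 (D.integral f + D.integral g)) := by
    simpa only [← riemannSum_add] using h
  exact tendsto_nhds_unique (D.tendsto_riemannSum_integral (hf.add hg)) h'

/-- **Subtractivity of the integral.** [folklore] -/
theorem integral_sub {f g : X → 𝕜} (hf : UniformContinuous f) (hg : UniformContinuous g) :
    D.integral (fun x => f x - g x) = D.integral f - D.integral g := by
  have h := (D.tendsto_riemannSum_integral hf).sub (D.tendsto_riemannSum_integral hg)
  have h' : Tendsto (D.riemannSum (fun x => f x - g x)) atTop (𝓝 (D.integral f - D.integral g)) := by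
    simpa only [← riemannSum_sub] using h
  exact tendsto_nhds_unique (D.tendsto_riemannSum_integral (hf.sub hg)) h'

/-- **Homogeneity of the integral.** [folklore] -/
theorem integral_const_mul (c : 𝕜) {f : X → 𝕜} (hf : UniformContinuous f) :
    D.integral (fun x => c * f x) = c * D.integral f := by
  have h := (D.tendsto_riemannSum_integral hf).const_mul c
  have h' : Tendsto (D.riemannSum (fun x => c * f x)) atTop (𝓝 (c * D.integral f)) := by
    simpa only [← riemannSum_const_mul] using h
  have hcf : UniformContinuous (fun x => c * f x) := by
    have := (uniformContinuous_const_smul (M := 𝕜) c).comp hf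
    simpa only [Function.comp_def, smul_eq_mul] using this
  exact tendsto_nhds_unique (D.tendsto_riemannSum_integral hcf) h'

omit [CompleteSpace 𝕜] in
/-- The integral of the zero function vanishes. [folklore] -/
theorem integral_zero_fun : D.integral (fun _ => (0 : 𝕜)) = 0 := by
  have h : D.riemannSum (fun _ => (0 : 𝕜)) = fun _ => 0 := funext fun n => D.riemannSum_zero n
  rw [integral, h]
  exact (tendsto_const_nhds (x := (0 : 𝕜)) (f := (atTop : Filter ℕ))).limUnder_eq

omit [CompleteSpace 𝕜] in
/-- **The integral of a locally constant function is a finite sum**: if `f = g ∘ proj m`, then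
`∫ f dμ = ∑_a μ m a · g a` — the Riemann sums are eventually constant, by the iterated distribution
relation; no continuity or completeness is needed (Mazur–Tate–Teitelbaum 1986, §I.11).
[cite: MazurTateTeitelbaum1986Invent, §I.11] -/
theorem integral_eq_sum_of_factorsThrough {f : X → 𝕜} {m : ℕ} (g : T.Cell m → 𝕜)
    (hfg : ∀ x, f x = g (T.proj m x)) : D.integral f = ∑ a : T.Cell m, D.μ m a * g a := by
  -- the Riemann sums at levels `m + k` all equal the level-`m` sum
  have hconst : ∀ k, D.riemannSum f (m + k) = ∑ a : T.Cell m, D.μ m a * g a := by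
    intro k
    rw [D.sum_mul_eq_sum_add m g k, riemannSum]
    refine Finset.sum_congr rfl fun b _ => ?_
    rw [hfg, T.proj_repr_add]
  have hev : (D.riemannSum f) =ᶠ[atTop] fun _ => ∑ a : T.Cell m, D.μ m a * g a :=
    Filter.eventually_atTop.mpr ⟨m, fun n hn => by
      obtain ⟨k, rfl⟩ := Nat.exists_eq_add_of_le hn
      exact hconst k⟩
  have ht : Tendsto (D.riemannSum f) atTop (𝓝 (∑ a : T.Cell m, D.μ m a * g a)) :=
    Tendsto.congr' hev.symm tendsto_const_nhds
  exact ht.limUnder_eq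

omit [CompleteSpace 𝕜] in
/-- In particular `∫ 1 dμ = ∑_a μ 0 a` (the total mass, read at level `0`). [folklore] -/
theorem integral_one : D.integral (fun _ => (1 : 𝕜)) = ∑ a : T.Cell 0, D.μ 0 a := by
  rw [D.integral_eq_sum_of_factorsThrough (m := 0) (fun _ => 1) (fun _ => rfl)]
  simp

/-- **Uniform limits pass under the integral**: if `‖f_k − f‖ ≤ e_k → 0` uniformly with all
functions uniformly continuous, then `∫ f_k dμ → ∫ f dμ` (from `‖∫ (f_k − f)‖ ≤ bound · e_k`).
[folklore] -/
theorem tendsto_integral_of_forall_norm_sub_le {F : ℕ → X → 𝕜} {f : X → 𝕜}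
    (hF : ∀ k, UniformContinuous (F k)) (hf : UniformContinuous f) {e : ℕ → ℝ}
    (he0 : ∀ k, 0 ≤ e k) (he : ∀ k x, ‖F k x - f x‖ ≤ e k) (hlim : Tendsto e atTop (𝓝 0)) :
    Tendsto (fun k => D.integral (F k)) atTop (𝓝 (D.integral f)) := by
  have hbound : ∀ k, ‖D.integral (F k) - D.integral f‖ ≤ D.bound * e k := fun k => by
    rw [← D.integral_sub (hF k) hf]
    exact D.norm_integral_le ((hF k).sub hf) (he0 k) (he k)
  have h0 : Tendsto (fun k => D.bound * e k) atTop (𝓝 0) := by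
    simpa using hlim.const_mul D.bound
  exact tendsto_iff_norm_sub_tendsto_zero.mpr (squeeze_zero (fun _ => norm_nonneg _) hbound h0)

end BoundedDistribution

/-! ### The tower `ℤ_p = lim ℤ/p^n` and products -/

namespace ProfiniteTower

variable (p : ℕ) [Fact p.Prime]

/-- **The `p`-adic tower**: `ℤ_p` with cells `ℤ/p^nℤ`, projections `toZModPow n`, transition maps
the canonical reductions, and representatives `a ↦ a.val ∈ ℕ ⊂ ℤ_p`.  Two `p`-adic integers with
the same reduction modulo `p^n` are at distance `≤ p^{-n}`. [folklore] -/
def padicInt : ProfiniteTower ℤ_[p] where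
  Cell n := ZMod (p ^ n)
  proj n := PadicInt.toZModPow n
  trans n := ZMod.castHom (pow_dvd_pow p n.le_succ) (ZMod (p ^ n))
  repr n a := (a.val : ℤ_[p])
  proj_repr n a := by
    haveI : NeZero (p ^ n) := ⟨pow_ne_zero _ (Fact.out : p.Prime).ne_zero⟩
    rw [map_natCast, ZMod.natCast_zmod_val]
  trans_proj n x := by
    rw [ZMod.castHom_apply, PadicInt.cast_toZModPow n (n + 1) n.le_succ]
  exists_forall_dist_lt ε hε := by
    have hp : p.Prime := Fact.out
    have hp1 : (1 : ℝ) < p := by exact_mod_cast hp.one_lt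
    obtain ⟨N, hN⟩ := exists_pow_lt_of_lt_one hε (inv_lt_one_of_one_lt₀ hp1)
    refine ⟨N, fun n hn x y hxy => ?_⟩
    have hker : x - y ∈ RingHom.ker (PadicInt.toZModPow n : ℤ_[p] →+* ZMod (p ^ n)) := by
      rw [RingHom.mem_ker, map_sub, hxy, sub_self]
    rw [PadicInt.ker_toZModPow, ← PadicInt.norm_le_pow_iff_mem_span_pow] at hker
    rw [dist_eq_norm]
    calc ‖x - y‖ ≤ (p : ℝ) ^ (-(n : ℤ)) := hker
      _ ≤ (p : ℝ) ^ (-(N : ℤ)) := zpow_le_zpow_right₀ hp1.le (by omega)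
      _ = ((p : ℝ)⁻¹) ^ N := by rw [zpow_neg, zpow_natCast, inv_pow]
      _ < ε := hN

/-- The cells of the `p`-adic tower are `ℤ/p^n`. [folklore] -/
@[simp] theorem padicInt_Cell (n : ℕ) : (padicInt p).Cell n = ZMod (p ^ n) := rfl

/-- The projections of the `p`-adic tower are `toZModPow`. [folklore] -/
@[simp] theorem padicInt_proj (n : ℕ) (x : ℤ_[p]) : (padicInt p).proj n x = PadicInt.toZModPow n x := rfl

/-- The transition maps of the `p`-adic tower are the canonical reductions. [folklore] -/
@[simp] theorem padicInt_trans (n : ℕ) (b : ZMod (p ^ (n + 1))) :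
    (padicInt p).trans n b = ZMod.castHom (pow_dvd_pow p n.le_succ) (ZMod (p ^ n)) b := rfl

/-- The representatives of the `p`-adic tower are `a ↦ a.val`. [folklore] -/
@[simp] theorem padicInt_repr (n : ℕ) (a : ZMod (p ^ n)) : (padicInt p).repr n a = (a.val : ℤ_[p]) :=
  rfl

variable {p}
variable {X Y : Type*} [PseudoMetricSpace X] [PseudoMetricSpace Y]

/-- **Products of towers** (e.g. `ℤ_p × ℤ_p` for two-variable measures): cells, projections,
transition maps and representatives componentwise; the product distance is the maximum of the
coordinate distances. [folklore] -/
def prod (T₁ : ProfiniteTower X) (T₂ : ProfiniteTower Y) : ProfiniteTower (X × Y) where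
  Cell n := T₁.Cell n × T₂.Cell n
  proj n z := (T₁.proj n z.1, T₂.proj n z.2)
  trans n b := (T₁.trans n b.1, T₂.trans n b.2)
  repr n a := (T₁.repr n a.1, T₂.repr n a.2)
  proj_repr n a := by rw [T₁.proj_repr, T₂.proj_repr]
  trans_proj n z := by rw [T₁.trans_proj, T₂.trans_proj]
  exists_forall_dist_lt ε hε := by
    obtain ⟨N₁, h₁⟩ := T₁.exists_forall_dist_lt ε hε
    obtain ⟨N₂, h₂⟩ := T₂.exists_forall_dist_lt ε hε
    refine ⟨max N₁ N₂, fun n hn z w hzw => ?_⟩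
    obtain ⟨h1, h2⟩ := Prod.mk.inj hzw
    rw [Prod.dist_eq]
    exact max_lt (h₁ n ((le_max_left _ _).trans hn) _ _ h1) (h₂ n ((le_max_right _ _).trans hn) _ _ h2)

/-- The cells of a product tower are pairs of cells. [folklore] -/
@[simp] theorem prod_Cell (T₁ : ProfiniteTower X) (T₂ : ProfiniteTower Y) (n : ℕ) :
    (T₁.prod T₂).Cell n = (T₁.Cell n × T₂.Cell n) := rfl

/-- The projections of a product tower are componentwise. [folklore] -/
@[simp] theorem prod_proj (T₁ : ProfiniteTower X) (T₂ : ProfiniteTower Y) (n : ℕ) (z : X × Y) :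
    (T₁.prod T₂).proj n z = (T₁.proj n z.1, T₂.proj n z.2) := rfl

/-- The transition maps of a product tower are componentwise. [folklore] -/
@[simp] theorem prod_trans (T₁ : ProfiniteTower X) (T₂ : ProfiniteTower Y) (n : ℕ)
    (b : T₁.Cell (n + 1) × T₂.Cell (n + 1)) :
    (T₁.prod T₂).trans n b = (T₁.trans n b.1, T₂.trans n b.2) := rfl

/-- The representatives of a product tower are componentwise. [folklore] -/
@[simp] theorem prod_repr (T₁ : ProfiniteTower X) (T₂ : ProfiniteTower Y) (n : ℕ)
    (a : T₁.Cell n × T₂.Cell n) : (T₁.prod T₂).repr n a = (T₁.repr n a.1, T₂.repr n a.2) := rfl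

end ProfiniteTower

/-! ### Bounded distributions on `ℤ_p` in the tree's form -/

namespace BoundedDistribution

variable {p : ℕ} [Fact p.Prime] {𝕜 : Type*} [NormedField 𝕜]

/-- **A bounded distribution on `ℤ_p` from level data in the tree's form** (`PAdicMeasureTransform`,
`msdMeasure`): `μ : (n : ℕ) → ℤ/p^n → 𝕜` with `∑_{b ≡ a (p^n)} μ (n+1) b = μ n a` and
`‖μ n a‖ ≤ C`. [folklore] -/
def ofPadicInt (μ : (n : ℕ) → ZMod (p ^ n) → 𝕜)
    (hdist : ∀ (n : ℕ) (a : ZMod (p ^ n)),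
      ∑ b ∈ Finset.univ.filter (fun b : ZMod (p ^ (n + 1)) =>
        ZMod.castHom (pow_dvd_pow p n.le_succ) (ZMod (p ^ n)) b = a), μ (n + 1) b = μ n a)
    {C : ℝ} (hC0 : 0 ≤ C) (hC : ∀ (n : ℕ) (a : ZMod (p ^ n)), ‖μ n a‖ ≤ C) :
    BoundedDistribution (ProfiniteTower.padicInt p) 𝕜 where
  μ := μ
  sum_fiber := hdist
  bound := C
  bound_nonneg := hC0
  norm_le := hC

/-- The level data of `ofPadicInt μ` is `μ`. [folklore] -/
@[simp] theorem ofPadicInt_μ (μ : (n : ℕ) → ZMod (p ^ n) → 𝕜) (hdist) {C : ℝ} (hC0 : 0 ≤ C) (hC)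
    (n : ℕ) (a : ZMod (p ^ n)) : (ofPadicInt μ hdist hC0 hC).μ n a = μ n a := rfl

/-- The bound of `ofPadicInt μ` is the given constant. [folklore] -/
@[simp] theorem ofPadicInt_bound (μ : (n : ℕ) → ZMod (p ^ n) → 𝕜) (hdist) {C : ℝ} (hC0 : 0 ≤ C)
    (hC) : (ofPadicInt μ hdist hC0 hC).bound = C := rfl

/-- The Riemann sums of `ofPadicInt μ` are `∑_{a mod p^n} μ n a · f (a.val)`. [folklore] -/
theorem riemannSum_ofPadicInt (μ : (n : ℕ) → ZMod (p ^ n) → 𝕜) (hdist) {C : ℝ} (hC0 : 0 ≤ C) (hC)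
    (f : ℤ_[p] → 𝕜) (n : ℕ) :
    (ofPadicInt μ hdist hC0 hC).riemannSum f n = ∑ a : ZMod (p ^ n), μ n a * f (a.val : ℤ_[p]) :=
  rfl

end BoundedDistribution

end Literature.NumberTheory.EllipticCurves

end
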